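/-
COR-CM (cell pub-hodgecm2) — BEYOND THE DOOR: the joint Hecke eigenvectors SPAN `H¹(X_Γ(ℂ); ℂ)`; `Alb X_Γ` is OF CM TYPE given
one Hodge type per joint Hecke eigencharacter; an occurring joint Hecke eigencharacter IS an occurring EIGENSYSTEM of the
commutative Hecke algebra `ℚ[T_S]` with its eigenblock and Hecke number field — all with (ℓ) and (t) discharged upstream, so
the displayed inputs are (c) commutativity on an inverse-closed `S` and (for the CM type) the one-type sentence.  Lane
«L-BYPASS LEAVES» (b10 gen 22): kernel text by the seat pub-hodgecm2-s2crux-idea-2 (probes RA-v35 Part N §N.2, RA-v36 Part O §O.2,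
gen 8; (ℓ)/(t)-free packaging by b10); filed by b10.  Count-neutral: no BINDER-OWNERS row, nothing under `B01/Transposition`,
Interfaces (C1) / E term untouched.  HC_CM is NOT proved; B01-S is NOT discharged; this file inhabits no binder of the END
display; it is the (M2)/CM-type/junction segment of ONE hedge derivation of B01-S whose remaining displayed inputs are printed
one-sentence facts ((c), the one-type sentence, the labelling and (E)-side sentences).
-/
import Summits.HodgeConjecture.CorCM.Geometry.HeckeAlgebraDoubleCoset
import Summits.HodgeConjecture.CorCM.Geometry.AlbaneseRangeBallQuotient
import Literature.AlgebraicGeometry.HodgeTheory.CMTypeOfSemisimpleRationalActionFamily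
import Literature.AlgebraicGeometry.ComplexMultiplication.JointEigenvectorEigensystemOfAdjoin
import Literature.AlgebraicGeometry.ComplexMultiplication.EigenblockOfCommutingEndomorphisms
import Literature.AlgebraicGeometry.HodgeTheory.ZariskiClosedNowhereDense
import HarnessLib

set_option autoImplicit false

/-!
# Joint Hecke eigenvectors on `H¹(X_Γ(ℂ); ℂ)`: spanning, CM type of the Albanese, occurring eigensystems

`X_Γ = Var.scheme hU h₃ (.pms (pmsCode L ι₁ V Γ))`; `T : U(V₃,h)(L) → End_ℚ H¹(X_Γ(ℂ); ℚ)` the bi-invariant Hecke family of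
`HeckeAlgebraDoubleCoset.exists_heckeAlgebra_isSemisimple_biInvariant` (Hodge endomorphisms, `ᵗT_γ = T_{γ⁻¹}`, `T_{δ₁γδ₂} = T_γ`,
and `ℚ[T_S]` semisimple for every inverse-closed commuting `S`).

* `Model.span_jointHeckeEigenvectors_and_isOfCMType` — for every inverse-closed `S ⊆ U(V₃,h)(L)` whose operators pairwise
  commute: (i) **every class of `H¹(X_Γ(ℂ); ℂ)` is a `ℂ`-combination of JOINT EIGENVECTORS of `(T_γ)_{γ ∈ S}`** (tree
  `mem_span_jointEigenvectors_of_isSemisimple`) — clause (M2) of the Hecke–Hodge dictionary as a theorem; (ii) **if every joint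
  eigencharacter of `(T_γ)_{γ ∈ S}` on `H¹` carries ONE Hodge type, then `Alb X_Γ` (every Albanese datum `𝒥`) is of CM type**
  (`CMTypeOfSemisimpleRationalActionFamily`; `b₁ ≤ 2 dim Alb` is the tree's `finrank_bettiCohomology_le_two_mul_dim_pms`) — the
  Murty–Ramakrishnan shape «the Albanese of a Picard modular surface is of CM type».
* `Model.exists_occurring_heckeEigensystem` — for such `S`, every joint `S`-eigencharacter `χ` OCCURRING in `H¹(X_Γ(ℂ); ℂ)`
  yields a commutative `ℚ`-algebra `R = ℚ[T_γ : γ ∈ S]`, its tautological action `act`, an OCCURRING EIGENSYSTEM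
  `t : R →ₐ[ℚ] ℂ` with `act r_γ = T_γ`, `t r_γ = χ γ`, every `act r` semisimple, the eigenblock `W(t) ≠ ⊥` and the Hecke field
  `E(t)` a number field (`JointEigenvectorEigensystemOfAdjoin`, tree `EigenblockOfCommutingEndomorphisms`).

References: V. K. Murty, D. Ramakrishnan, *The Albanese of unitary Shimura varieties*, in *The zeta functions of Picard modular
surfaces* (CRM Montréal, 1992), pp. 445–464 [MurtyRamakrishnan1992]; P. Deligne, *Hodge cycles on abelian varieties*, LNM 900
(1982), §4 [Deligne1982HodgeCycles]; G. Shimura, *Introduction to the Arithmetic Theory of Automorphic Functions* (1971),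
§3.2–3.4, §7.2 [Shimura1971].
-/

noncomputable section

namespace Summit.HodgeConjecture.CorCM

namespace Model

open CategoryTheory Matrix
open NumberField Literature.NumberTheory.Automorphic
open Literature.AlgebraicGeometry.Motives (SchemeOver ComplexPoints AlgPoints bettiCohomology Jacobian IsSmoothProjective
  ofRatClassBaseChange)
open Literature.AlgebraicGeometry.HodgeTheory
open Literature.AlgebraicGeometry.Milne1999 (IsOfCMType)
open Literature.AlgebraicGeometry.ComplexMultiplication
open Literature.AlgebraicGeometry.ShimuraVarieties
open Literature.AlgebraicTopology.SingularHomology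
open Literature.NumberTheory.Automorphic.PicardCM
open scoped TensorProduct

section BeyondTheDoor

variable {hU : BallQuotientUniformisedDatum} {h₃ : CMAbelianVarietyRealised}
variable {L : CMField} {ι₁ : L →+* ℂ} {V : HermSpace3 L ι₁}

/-- **(M2) and the CM type of `Alb X_Γ`, given (c) and the one-type sentence only.** The bi-invariant Hecke family
`T_γ = τ'_{f₁} ∘ g^*` of `HeckeAlgebraDoubleCoset` (with its pairs,
Hodge, transpose and double-coset clauses) satisfies, for every inverse-closed set `S` of `γ`'s whose operators
pairwise commute ((c), printed for the spherical family): (i) every class of `H¹(X_Γ(ℂ); ℂ)` is a `ℂ`-linear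
combination of JOINT EIGENVECTORS of `(T_γ)_{γ ∈ S}` — clause (M2) of the dictionary as a THEOREM; (ii) if every joint
eigencharacter `χ` of `(T_γ)_{γ ∈ S}` carries one Hodge type, then every Albanese datum `𝒥` of `X_Γ` has `𝒥.J` of CM
type. [cite: MurtyRamakrishnan1992, pp. 445–464] [cite: Deligne1982HodgeCycles, §4] [cite: Shimura1971, §3.2–3.4 and §7.2] -/
theorem span_jointHeckeEigenvectors_and_isOfCMType (hHD : exists_isReal_hodgeModel)
    (hI : hodgePQ_independent_of_hodgeModel) (Γ : Level V)
    (h : (pmsCode L ι₁ V Γ).IsAnisotropic) :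
    ∃ T T' : ↥(unitaryGroup (cmConjRingHom L) V.Hm) →
        Module.End ℚ (bettiCohomology (Var.scheme hU h₃ (.pms (pmsCode L ι₁ V Γ))) 1),
      (∀ γ : ↥(unitaryGroup (cmConjRingHom L) V.Hm),
        ∃ (f₁ g : Var.scheme hU h₃ (.pms (pmsCode L ι₁ V (Γ.heckePair (γ : GL (Fin 3) L) γ.2))) ⟶
            Var.scheme hU h₃ (.pms (pmsCode L ι₁ V Γ)))
          (c₁ : IsFiniteCover (AlgPoints.mapContinuous (L := ℂ) f₁))
          (c₂ : IsFiniteCover (AlgPoints.mapContinuous (L := ℂ) g)),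
          (∀ v ∈ (Var.ballDatum hU h₃ (pmsCode L ι₁ V (Γ.heckePair (γ : GL (Fin 3) L) γ.2))
              ((isAnisotropic_pmsCode_iff_of_level Γ (Γ.heckePair (γ : GL (Fin 3) L) γ.2)).2 h)).cone,
            AlgPoints.map f₁ ((Var.ballDatum hU h₃ (pmsCode L ι₁ V (Γ.heckePair (γ : GL (Fin 3) L) γ.2))
              ((isAnisotropic_pmsCode_iff_of_level Γ (Γ.heckePair (γ : GL (Fin 3) L) γ.2)).2 h)).unif v) =
              (Var.ballDatum hU h₃ (pmsCode L ι₁ V Γ) h).unif v) ∧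
          (∀ v ∈ (Var.ballDatum hU h₃ (pmsCode L ι₁ V (Γ.heckePair (γ : GL (Fin 3) L) γ.2))
              ((isAnisotropic_pmsCode_iff_of_level Γ (Γ.heckePair (γ : GL (Fin 3) L) γ.2)).2 h)).cone,
            AlgPoints.map g ((Var.ballDatum hU h₃ (pmsCode L ι₁ V (Γ.heckePair (γ : GL (Fin 3) L) γ.2))
              ((isAnisotropic_pmsCode_iff_of_level Γ (Γ.heckePair (γ : GL (Fin 3) L) γ.2)).2 h)).unif v) =
              (Var.ballDatum hU h₃ (pmsCode L ι₁ V Γ) h).unif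
                ((((γ : GL (Fin 3) L) : Matrix (Fin 3) (Fin 3) L).map ι₁) *ᵥ v)) ∧
          T γ = (c₁.transferMap (R := ℚ) 1).hom ∘ₗ BettiUniverse.pull g 1 ∧
          T' γ = (c₂.transferMap (R := ℚ) 1).hom ∘ₗ BettiUniverse.pull f₁ 1) ∧
      (∀ γ, T γ ∈ (BettiUniverse.hodge hHD (Var.isSmoothProjective hU h₃ (.pms (pmsCode L ι₁ V Γ))) 1).endAlg) ∧
      (∀ γ, T' γ = T γ⁻¹) ∧
      (∀ (γ : ↥(unitaryGroup (cmConjRingHom L) V.Hm)) (δ₁ δ₂ : GL (Fin 3) L) (hδ₁ : δ₁ ∈ Γ.Γ) (hδ₂ : δ₂ ∈ Γ.Γ),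
        T ⟨δ₁ * (γ : GL (Fin 3) L) * δ₂,
            mul_mem (mul_mem (Γ.isCongruence.1 hδ₁) γ.2) (Γ.isCongruence.1 hδ₂)⟩ = T γ) ∧
      (∀ S : Set ↥(unitaryGroup (cmConjRingHom L) V.Hm), (∀ γ ∈ S, γ⁻¹ ∈ S) →
        (∀ γ ∈ S, ∀ δ ∈ S, Commute (T γ) (T δ)) →
        ∀ a ∈ Algebra.adjoin ℚ (Set.range fun δ : S => T δ), Module.End.IsSemisimple a) ∧
      ∀ S : Set ↥(unitaryGroup (cmConjRingHom L) V.Hm), (∀ γ ∈ S, γ⁻¹ ∈ S) →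
        (∀ γ ∈ S, ∀ δ ∈ S, Commute (T γ) (T δ)) →
        (∀ x : ℂ ⊗[ℚ] bettiCohomology (Var.scheme hU h₃ (.pms (pmsCode L ι₁ V Γ))) 1,
          x ∈ Submodule.span ℂ {w : ℂ ⊗[ℚ] bettiCohomology (Var.scheme hU h₃ (.pms (pmsCode L ι₁ V Γ))) 1 |
            ∃ χ : ↥S → ℂ, ∀ δ : ↥S, (T δ).baseChange ℂ w = χ δ • w}) ∧
        ((∀ χ : ↥S → ℂ,
          (∀ w, (∀ δ : ↥S, (T δ).baseChange ℂ w = χ δ • w) →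
            IsOfHodgeType 2 (Var.scheme hU h₃ (.pms (pmsCode L ι₁ V Γ))) 1 1 0
              (ofRatClassBaseChange (ComplexPoints (Var.scheme hU h₃ (.pms (pmsCode L ι₁ V Γ)))) 1 w)) ∨
          (∀ w, (∀ δ : ↥S, (T δ).baseChange ℂ w = χ δ • w) →
            IsOfHodgeType 2 (Var.scheme hU h₃ (.pms (pmsCode L ι₁ V Γ))) 1 0 1
              (ofRatClassBaseChange (ComplexPoints (Var.scheme hU h₃ (.pms (pmsCode L ι₁ V Γ)))) 1 w))) →
          ∀ 𝒥 : Jacobian (Var.scheme hU h₃ (.pms (pmsCode L ι₁ V Γ))), IsOfCMType 𝒥.J) := by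
  obtain ⟨T, T', hpair, hT, ht, hbi, hfam⟩ :=
    exists_heckeAlgebra_isSemisimple_biInvariant (hU := hU) (h₃ := h₃) hHD hI Γ h
  have hX : IsSmoothProjective 2 (Var.scheme hU h₃ (.pms (pmsCode L ι₁ V Γ))) := Var.isSmoothProjective hU h₃ (.pms (pmsCode L ι₁ V Γ))
  haveI : FiniteDimensional ℚ (bettiCohomology (Var.scheme hU h₃ (.pms (pmsCode L ι₁ V Γ))) 1) := finiteDimensional_bettiCohomology hX 1
  refine ⟨T, T', hpair, hT, ht, hbi, hfam, fun S hS hc => ⟨fun x => ?_, fun htype 𝒥 => ?_⟩⟩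
  · exact mem_span_jointEigenvectors_of_isSemisimple (fun δ : ↥S => T δ) (fun k l => (hc k k.2 l l.2).eq)
      (fun k => hfam S hS hc (T k) (Algebra.subset_adjoin ⟨k, rfl⟩)) x
  · obtain ⟨P⟩ := nonempty_complexPoints hX
    exact Jacobian.isOfCMType_of_adjoin_isSemisimple_of_oneType hX 𝒥 P
      (finrank_bettiCohomology_le_two_mul_dim_pms (pmsCode L ι₁ V Γ) h 𝒥) (fun δ : ↥S => T δ)
      (fun k l => hc k k.2 l l.2) (hfam S hS hc) htype

open scoped IsMulCommutative in
/-- **The junction to the END display of the Hecke–Hodge dictionary line.**  The bi-invariant Hecke family `T_γ = τ'_{f₁} ∘ g^*` on `H¹(X_Γ(ℂ); ℚ)`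
(with its pairs, Hodge, transpose, double-coset and semisimplicity clauses) satisfies: for every inverse-closed `S`
with (c) and every joint `S`-eigencharacter `χ` OCCURRING in `H¹(X_Γ(ℂ); ℂ)` (a non-zero joint eigenvector `w`),
there are a commutative `ℚ`-algebra `R` (namely `ℚ[T_γ : γ ∈ S] ⊆ End_ℚ H¹`), its tautological action `act`, and an
OCCURRING EIGENSYSTEM `t : R →ₐ[ℚ] ℂ` with `act r_γ = T_γ`, `t r_γ = χ γ`, every `act r` semisimple and in
`ℚ[T_S]`, the eigenblock `W(t) ≠ ⊥` and the Hecke field `E(t)` a number field — literally the data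
`(R, act, t, hocc)` that an eigensystem-supply hypothesis of the hedge lane's END display (seat pub-hodgecm2-s2crux-idea-2,
`S2CruxRA.exists_raOperatorSpec` in its unfiled RA-v44/45) asks for — supplied here as a theorem.
[cite: MurtyRamakrishnan1992, pp. 445–464] [cite: Deligne1982HodgeCycles, §4] [cite: Shimura1971, §3.2–3.4 and §7.2] -/
theorem exists_occurring_heckeEigensystem (hHD : exists_isReal_hodgeModel)
    (hI : hodgePQ_independent_of_hodgeModel) (Γ : Level V)
    (h : (pmsCode L ι₁ V Γ).IsAnisotropic) :
    ∃ T T' : ↥(unitaryGroup (cmConjRingHom L) V.Hm) →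
        Module.End ℚ (bettiCohomology (Var.scheme hU h₃ (.pms (pmsCode L ι₁ V Γ))) 1),
      (∀ γ : ↥(unitaryGroup (cmConjRingHom L) V.Hm),
        ∃ (f₁ g : Var.scheme hU h₃ (.pms (pmsCode L ι₁ V (Γ.heckePair (γ : GL (Fin 3) L) γ.2))) ⟶
            Var.scheme hU h₃ (.pms (pmsCode L ι₁ V Γ)))
          (c₁ : IsFiniteCover (AlgPoints.mapContinuous (L := ℂ) f₁))
          (c₂ : IsFiniteCover (AlgPoints.mapContinuous (L := ℂ) g)),
          (∀ v ∈ (Var.ballDatum hU h₃ (pmsCode L ι₁ V (Γ.heckePair (γ : GL (Fin 3) L) γ.2))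
              ((isAnisotropic_pmsCode_iff_of_level Γ (Γ.heckePair (γ : GL (Fin 3) L) γ.2)).2 h)).cone,
            AlgPoints.map f₁ ((Var.ballDatum hU h₃ (pmsCode L ι₁ V (Γ.heckePair (γ : GL (Fin 3) L) γ.2))
              ((isAnisotropic_pmsCode_iff_of_level Γ (Γ.heckePair (γ : GL (Fin 3) L) γ.2)).2 h)).unif v) =
              (Var.ballDatum hU h₃ (pmsCode L ι₁ V Γ) h).unif v) ∧
          (∀ v ∈ (Var.ballDatum hU h₃ (pmsCode L ι₁ V (Γ.heckePair (γ : GL (Fin 3) L) γ.2))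
              ((isAnisotropic_pmsCode_iff_of_level Γ (Γ.heckePair (γ : GL (Fin 3) L) γ.2)).2 h)).cone,
            AlgPoints.map g ((Var.ballDatum hU h₃ (pmsCode L ι₁ V (Γ.heckePair (γ : GL (Fin 3) L) γ.2))
              ((isAnisotropic_pmsCode_iff_of_level Γ (Γ.heckePair (γ : GL (Fin 3) L) γ.2)).2 h)).unif v) =
              (Var.ballDatum hU h₃ (pmsCode L ι₁ V Γ) h).unif
                ((((γ : GL (Fin 3) L) : Matrix (Fin 3) (Fin 3) L).map ι₁) *ᵥ v)) ∧
          T γ = (c₁.transferMap (R := ℚ) 1).hom ∘ₗ BettiUniverse.pull g 1 ∧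
          T' γ = (c₂.transferMap (R := ℚ) 1).hom ∘ₗ BettiUniverse.pull f₁ 1) ∧
      (∀ γ, T γ ∈ (BettiUniverse.hodge hHD
        (Var.isSmoothProjective hU h₃ (.pms (pmsCode L ι₁ V Γ))) 1).endAlg) ∧
      (∀ γ, T' γ = T γ⁻¹) ∧
      (∀ (γ : ↥(unitaryGroup (cmConjRingHom L) V.Hm)) (δ₁ δ₂ : GL (Fin 3) L) (hδ₁ : δ₁ ∈ Γ.Γ) (hδ₂ : δ₂ ∈ Γ.Γ),
        T ⟨δ₁ * (γ : GL (Fin 3) L) * δ₂,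
            mul_mem (mul_mem (Γ.isCongruence.1 hδ₁) γ.2) (Γ.isCongruence.1 hδ₂)⟩ = T γ) ∧
      (∀ S : Set ↥(unitaryGroup (cmConjRingHom L) V.Hm), (∀ γ ∈ S, γ⁻¹ ∈ S) →
        (∀ γ ∈ S, ∀ δ ∈ S, Commute (T γ) (T δ)) →
        ∀ a ∈ Algebra.adjoin ℚ (Set.range fun δ : S => T δ), Module.End.IsSemisimple a) ∧
      ∀ S : Set ↥(unitaryGroup (cmConjRingHom L) V.Hm), (∀ γ ∈ S, γ⁻¹ ∈ S) →
        (∀ γ ∈ S, ∀ δ ∈ S, Commute (T γ) (T δ)) →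
        ∀ (χ : ↥S → ℂ) (w : ℂ ⊗[ℚ] bettiCohomology (Var.scheme hU h₃ (.pms (pmsCode L ι₁ V Γ))) 1), w ≠ 0 →
          (∀ δ : ↥S, (T δ).baseChange ℂ w = χ δ • w) →
          ∃ (R : Type) (_ : CommRing R) (_ : Algebra ℚ R)
            (act : R →ₐ[ℚ] Module.End ℚ (bettiCohomology (Var.scheme hU h₃ (.pms (pmsCode L ι₁ V Γ))) 1))
            (t : R →ₐ[ℚ] ℂ),
            (∀ δ : ↥S, ∃ r : R, act r = T δ ∧ t r = χ δ) ∧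
            (∀ r : R, act r ∈ Algebra.adjoin ℚ (Set.range fun δ : ↥S => T δ)) ∧
            (∀ r : R, (act r).IsSemisimple) ∧
            (∃ x : ℂ ⊗[ℚ] bettiCohomology (Var.scheme hU h₃ (.pms (pmsCode L ι₁ V Γ))) 1,
              x ≠ 0 ∧ ∀ r, (act r).baseChange ℂ x = t r • x) ∧
            eigenblock act t ≠ ⊥ ∧ NumberField (eigenfield t) := by
  obtain ⟨T, T', hpair, hT, ht, hbi, hfam⟩ :=
    exists_heckeAlgebra_isSemisimple_biInvariant (hU := hU) (h₃ := h₃) hHD hI Γ h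
  have hX : IsSmoothProjective 2 (Var.scheme hU h₃ (.pms (pmsCode L ι₁ V Γ))) :=
    Var.isSmoothProjective hU h₃ (.pms (pmsCode L ι₁ V Γ))
  haveI : FiniteDimensional ℚ (bettiCohomology (Var.scheme hU h₃ (.pms (pmsCode L ι₁ V Γ))) 1) :=
    finiteDimensional_bettiCohomology hX 1
  refine ⟨T, T', hpair, hT, ht, hbi, hfam, fun S hS hc χ w hw0 hw => ?_⟩
  haveI := Algebra.isMulCommutative_adjoin ℚ (s := Set.range fun δ : ↥S => T δ)
    (by rintro _ ⟨k, rfl⟩ _ ⟨l, rfl⟩; exact (hc k k.2 l l.2).eq)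
  obtain ⟨t, htχ, htw⟩ := exists_algHom_adjoin_of_jointEigenvector_ne_zero (fun δ : ↥S => T δ)
    (fun k l => hc k k.2 l l.2) hw hw0
  have hocc : ∃ x : ℂ ⊗[ℚ] bettiCohomology (Var.scheme hU h₃ (.pms (pmsCode L ι₁ V Γ))) 1,
      x ≠ 0 ∧ ∀ r, ((Algebra.adjoin ℚ (Set.range fun δ : ↥S => T δ)).val r).baseChange ℂ x = t r • x :=
    ⟨w, hw0, fun r => htw r⟩
  exact ⟨↥(Algebra.adjoin ℚ (Set.range fun δ : ↥S => T δ)), inferInstance, inferInstance,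
    (Algebra.adjoin ℚ (Set.range fun δ : ↥S => T δ)).val, t,
    fun δ => ⟨⟨T δ, Algebra.subset_adjoin ⟨δ, rfl⟩⟩, rfl, htχ δ⟩, fun r => r.2,
    fun r => hfam S hS hc r r.2, hocc, eigenblock_ne_bot _ t hocc, numberField_eigenfield _ t hocc⟩

end BeyondTheDoor

end Model

end Summit.HodgeConjecture.CorCM

end
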